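import Summits.CriticalPhenomena.PercolationContinuityZ3.Theorems.PercGamblersRuinVerticalGamblersRuinStubReflectedComplement

/-!
# `stub_heightSymmetry` of line `registered` (crux `VerticalGamblersRuin`, stmt-CriticalPhenomena-10642):
# reflection symmetry `x₀ ↦ -x₀` of the annealed law of the height of the walk at a deterministic time

Route `PercGamblersRuin` of `PercolationContinuityZ3`, skeleton rev 9 (the Paley–Zygmund split of the
anti-concentration criterion) of the line `registered` (`Cruxes/VerticalGamblersRuin/Lines/birth.lean`),
stub `stub_heightSymmetry`.

Setting: bond configurations `ω` on `ℤ³` under `P = P_{p_c}`; `N_ω(x)` is the set of lattice neighbours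
`y ∼ x` with `s(x, y)` open in `ω`, `deg_ω(0) = #N_ω(0)`; the averaging operator of the simple random
walk on the open edges is `(𝒫_ω g)(x) = (∑_{y ∈ N_ω(x)} g y) / #N_ω(x)` (`0 / 0 = 0`), entering the
statement as a universally quantified `Pop` pinned by its formula, and `(𝒫_ω^[T] f)(0) = E^ω_0[f(X_T)]`.

Statement proved (exact registered signature): for every `T : ℕ` and `n : ℤ`,
`∫_{0↔∞} deg_ω(0) · (𝒫_ω^[T] 1_{n ≤ x₀})(0) dP = ∫_{0↔∞} deg_ω(0) · (𝒫_ω^[T] 1_{x₀ ≤ -n})(0) dP`,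
i.e. the annealed (degree-biased) law of the height `h(X_T)` at the deterministic time `T` is symmetric:
`P̃(h(X_T) ≥ n) = P̃(h(X_T) ≤ -n)`.

Proof.  Let `r : x₀ ↦ -x₀` be the reflection (`Site.signedPerm`, a lattice automorphism fixing `0`,
`SymmetricSlab.refl_apply_zero` / `adj_refl_iff`) and `R = BondConfig.relabel (sym2Equiv r)` the induced
relabelling of configurations.
* COVARIANCE (`iterate_pop_relabel_apply`): `(𝒫_{Rω}^[T] g)(r x) = (𝒫_ω^[T] (g ∘ r))(x)` for all `g`, `x`
  — one step (`pop_relabel_apply`): `y ↦ r y` is a bijection from `N_ω(x)` onto `N_{Rω}(r x)`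
  (`mk_mem_relabel_iff`), and the iterate follows from `Function.Semiconj.iterate_right` for the
  semiconjugacy `g ↦ g ∘ r`.  With `r 0 = 0` and `1_{n ≤ ·₀} ∘ r = 1_{·₀ ≤ -n}` (`(r x)₀ = -x₀`, `le_neg`):
  `(𝒫_{Rω}^[T] 1_{n ≤ x₀})(0) = (𝒫_ω^[T] 1_{x₀ ≤ -n})(0)`.
* `P` is `R`-invariant (`bondPercolation_map_relabel_iso`), `R ⁻¹' {0↔∞} = {0↔∞}`
  (`relabel_mem_percolatesAt_iff`) and `deg_{Rω}(0) = deg_ω(0)` (`StubReflectedComplement.card_filter_relabel`),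
  so `∫_{0↔∞} deg_ω(0) (𝒫_ω^[T] 1_{n ≤ x₀})(0) dP = ∫_{0↔∞} deg_{Rω}(0) (𝒫_{Rω}^[T] 1_{n ≤ x₀})(0) dP`
  (`MeasurePreserving.setIntegral_preimage_emb`, no integrability needed) and the integrands of the last
  integral and of the right-hand side agree pointwise (`setIntegral_congr_fun`).

References: G. Grimmett, *Percolation*, 2nd ed., Springer (1999), §1.6 (lattice symmetries of `P_p`);
A. De Masi, P. A. Ferrari, S. Goldstein, W. D. Wick, J. Statist. Phys. 55 (1989), §4 (the degree-biased
cluster law and the walk on the cluster).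
-/

noncomputable section

namespace Summit.CriticalPhenomena.PercolationContinuityZ3.Theorems.VerticalGamblersRuin

open MeasureTheory Filter Topology
open Literature.Probability.Percolation Literature.Probability.LatticeModels
open scoped Classical

namespace StubHeightSymmetry

/-! ### Covariance of the averaging operator under a lattice automorphism -/

/-- **One-step covariance.**  For a lattice automorphism `r` of `ℤ³` and `R = BondConfig.relabel (sym2Equiv r)`:
`(𝒫_{Rω} g)(r x) = (𝒫_ω (g ∘ r))(x)` — `y ↦ r y` is a bijection from the open neighbours of `x` in `ω`
onto the open neighbours of `r x` in `R ω` (`mk_mem_relabel_iff`), so the sums and the cards agree. -/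
theorem pop_relabel_apply {Pop : BondConfig (Site 3) → (Site 3 → ℝ) → Site 3 → ℝ}
    (hPop : ∀ ω (g : Site 3 → ℝ) (x : Site 3), Pop ω g x =
      (∑ y ∈ ((zdGraph 3).neighborFinset x).filter (fun y => s(x, y) ∈ ω), g y) /
        ((((zdGraph 3).neighborFinset x).filter (fun y => s(x, y) ∈ ω)).card : ℝ))
    (r : Site 3 ≃ Site 3) (hadj : ∀ x y, (zdGraph 3).Adj (r x) (r y) ↔ (zdGraph 3).Adj x y)
    (ω : BondConfig (Site 3)) (g : Site 3 → ℝ) (x : Site 3) :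
    Pop (BondConfig.relabel (sym2Equiv r) ω) g (r x) = Pop ω (g ∘ r) x := by
  -- adapted from `StubReflectedComplement.reflect_harmonic_of_mapsTo` / `card_filter_relabel`
  have hmem : ∀ y, y ∈ ((zdGraph 3).neighborFinset x).filter (fun y => s(x, y) ∈ ω) ↔
      r y ∈ ((zdGraph 3).neighborFinset (r x)).filter
        (fun y => s(r x, y) ∈ BondConfig.relabel (sym2Equiv r) ω) := fun y => by
    simp only [Finset.mem_filter, SimpleGraph.mem_neighborFinset, hadj, mk_mem_relabel_iff]
  have hsum : ∑ y ∈ ((zdGraph 3).neighborFinset x).filter (fun y => s(x, y) ∈ ω), (g ∘ r) y =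
      ∑ y ∈ ((zdGraph 3).neighborFinset (r x)).filter
        (fun y => s(r x, y) ∈ BondConfig.relabel (sym2Equiv r) ω), g y :=
    Finset.sum_equiv r hmem (fun y _ => rfl)
  have hcard : (((zdGraph 3).neighborFinset x).filter (fun y => s(x, y) ∈ ω)).card =
      (((zdGraph 3).neighborFinset (r x)).filter
        (fun y => s(r x, y) ∈ BondConfig.relabel (sym2Equiv r) ω)).card :=
    Finset.card_equiv r hmem
  rw [hPop, hPop, hsum, hcard]

/-- **Covariance of the iterates.**  For a lattice automorphism `r` of `ℤ³`, `R = BondConfig.relabel (sym2Equiv r)`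
and every `T`: `(𝒫_{Rω}^[T] g)(r x) = (𝒫_ω^[T] (g ∘ r))(x)` (the map `g ↦ g ∘ r` semiconjugates `𝒫_{Rω}` to
`𝒫_ω` by `pop_relabel_apply`, hence their iterates, `Function.Semiconj.iterate_right`). -/
theorem iterate_pop_relabel_apply {Pop : BondConfig (Site 3) → (Site 3 → ℝ) → Site 3 → ℝ}
    (hPop : ∀ ω (g : Site 3 → ℝ) (x : Site 3), Pop ω g x =
      (∑ y ∈ ((zdGraph 3).neighborFinset x).filter (fun y => s(x, y) ∈ ω), g y) /
        ((((zdGraph 3).neighborFinset x).filter (fun y => s(x, y) ∈ ω)).card : ℝ))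
    (r : Site 3 ≃ Site 3) (hadj : ∀ x y, (zdGraph 3).Adj (r x) (r y) ↔ (zdGraph 3).Adj x y)
    (ω : BondConfig (Site 3)) (T : ℕ) (g : Site 3 → ℝ) (x : Site 3) :
    ((Pop (BondConfig.relabel (sym2Equiv r) ω))^[T] g) (r x) = ((Pop ω)^[T] (g ∘ r)) x := by
  have hsemi : Function.Semiconj (fun g : Site 3 → ℝ => g ∘ r)
      (Pop (BondConfig.relabel (sym2Equiv r) ω)) (Pop ω) := fun g =>
    funext fun x => pop_relabel_apply hPop r hadj ω g x
  have h := (hsemi.iterate_right T).eq g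
  exact (congrFun h x :)

end StubHeightSymmetry

open SymmetricSlab StubReflectedComplement StubHeightSymmetry in
/-- **stub `stub_heightSymmetry` of line `registered` (crux `VerticalGamblersRuin`,
stmt-CriticalPhenomena-10642; skeleton rev 9): reflection symmetry of the annealed law of the height at a
deterministic time.**  For every `T : ℕ`, `n : ℤ` and the SRW averaging operator `𝒫` on the open edges:
`∫_{0↔∞} deg_ω(0) · (𝒫_ω^[T] 1_{n ≤ x₀})(0) dP_{p_c} = ∫_{0↔∞} deg_ω(0) · (𝒫_ω^[T] 1_{x₀ ≤ -n})(0) dP_{p_c}`.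
The reflection `r : x₀ ↦ -x₀` fixes `0`, preserves `P_{p_c}`, `{0↔∞}` and `deg_·(0)`, so the left side equals
`∫_{0↔∞} deg_{Rω}(0) (𝒫_{Rω}^[T] 1_{n ≤ x₀})(0) dP`, and pointwise
`(𝒫_{Rω}^[T] 1_{n ≤ x₀})(0) = (𝒫_ω^[T] (1_{n ≤ x₀} ∘ r))(0) = (𝒫_ω^[T] 1_{x₀ ≤ -n})(0)` (covariance). -/
theorem stub_heightSymmetry :
    ∀ (T : ℕ) (n : ℤ),
      ∀ Pop : BondConfig (Site 3) → (Site 3 → ℝ) → Site 3 → ℝ,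
        (∀ ω (g : Site 3 → ℝ) (x : Site 3), Pop ω g x =
          (∑ y ∈ ((zdGraph 3).neighborFinset x).filter (fun y => s(x, y) ∈ ω), g y) /
            ((((zdGraph 3).neighborFinset x).filter (fun y => s(x, y) ∈ ω)).card : ℝ)) →
        ∫ ω in percolatesAt (0 : Site 3),
            ((((zdGraph 3).neighborFinset (0 : Site 3)).filter
                (fun y => s((0 : Site 3), y) ∈ ω)).card : ℝ) *
              ((Pop ω)^[T] (fun x => if n ≤ x 0 then (1 : ℝ) else 0)) 0
            ∂(bondPercolation (zdGraph 3) (criticalProbI 3)) =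
          ∫ ω in percolatesAt (0 : Site 3),
            ((((zdGraph 3).neighborFinset (0 : Site 3)).filter
                (fun y => s((0 : Site 3), y) ∈ ω)).card : ℝ) *
              ((Pop ω)^[T] (fun x => if x 0 ≤ -n then (1 : ℝ) else 0)) 0
            ∂(bondPercolation (zdGraph 3) (criticalProbI 3)) := by
  intro T n Pop hPop
  -- the reflection `x₀ ↦ -x₀`: height-negating, fixes `0`, lattice automorphism, preserves `P_{p_c}`
  -- (adapted from `StubCoreOfVGR.setIntegral_symm_eq` and `stub_reflectedComplement`)
  obtain ⟨r, hr, hr0, hadj, hmap⟩ : ∃ r : Site 3 ≃ Site 3, (∀ x : Site 3, (r x) 0 = -(x 0)) ∧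
      r 0 = 0 ∧ (∀ x y, (zdGraph 3).Adj (r x) (r y) ↔ (zdGraph 3).Adj x y) ∧
      Measure.map (BondConfig.relabel (sym2Equiv r)) (bondPercolation (zdGraph 3) (criticalProbI 3)) =
        bondPercolation (zdGraph 3) (criticalProbI 3) :=
    ⟨Site.signedPerm (d := 3) (Equiv.refl (Fin 3)) (Function.update 1 0 (-1)), refl_apply_zero,
      Site.signedPerm_zero _ _, adj_refl_iff,
      bondPercolation_map_relabel_iso
        (zdSignedPermIso (d := 3) (Equiv.refl (Fin 3)) (Function.update 1 0 (-1))) (criticalProbI 3)⟩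
  set P := bondPercolation (zdGraph 3) (criticalProbI 3) with hPdef
  have hmp : MeasurePreserving (BondConfig.relabel (sym2Equiv r)) P P :=
    ⟨(BondConfig.relabel (sym2Equiv r)).measurable, hmap⟩
  -- `{0 ↔ ∞}` is `R`-invariant
  have hpre : BondConfig.relabel (sym2Equiv r) ⁻¹' (percolatesAt (0 : Site 3) : Set (BondConfig (Site 3))) =
      percolatesAt (0 : Site 3) := by
    ext ω
    have h := relabel_mem_percolatesAt_iff r ω 0
    rw [hr0] at h
    exact h
  -- the reflected indicator: `1_{n ≤ ·₀} ∘ r = 1_{·₀ ≤ -n}`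
  have hind : ((fun x : Site 3 => if n ≤ x 0 then (1 : ℝ) else 0) ∘ r) =
      fun x : Site 3 => if x 0 ≤ -n then (1 : ℝ) else 0 := by
    funext x
    simp only [Function.comp_apply, hr, le_neg (a := n) (b := x 0)]
  -- covariance at the origin: `(𝒫_{Rω}^[T] 1_{n ≤ x₀})(0) = (𝒫_ω^[T] 1_{x₀ ≤ -n})(0)`
  have hcov : ∀ ω : BondConfig (Site 3),
      ((Pop (BondConfig.relabel (sym2Equiv r) ω))^[T] (fun x => if n ≤ x 0 then (1 : ℝ) else 0)) 0 =
        ((Pop ω)^[T] (fun x => if x 0 ≤ -n then (1 : ℝ) else 0)) 0 := fun ω => by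
    have h := iterate_pop_relabel_apply hPop r hadj ω T (fun x => if n ≤ x 0 then (1 : ℝ) else 0) 0
    rw [hr0, hind] at h
    exact h
  -- `∫_{0↔∞} deg_{Rω}(0) (𝒫_{Rω}^[T] f)(0) dP = ∫_{0↔∞} deg_ω(0) (𝒫_ω^[T] f)(0) dP`
  have hswap : ∫ ω in percolatesAt (0 : Site 3),
      ((((zdGraph 3).neighborFinset (0 : Site 3)).filter
        (fun y => s((0 : Site 3), y) ∈ BondConfig.relabel (sym2Equiv r) ω)).card : ℝ) *
          ((Pop (BondConfig.relabel (sym2Equiv r) ω))^[T]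
            (fun x => if n ≤ x 0 then (1 : ℝ) else 0)) 0 ∂P =
      ∫ ω in percolatesAt (0 : Site 3),
        ((((zdGraph 3).neighborFinset (0 : Site 3)).filter
          (fun y => s((0 : Site 3), y) ∈ ω)).card : ℝ) *
            ((Pop ω)^[T] (fun x => if n ≤ x 0 then (1 : ℝ) else 0)) 0 ∂P := by
    have h := hmp.setIntegral_preimage_emb (BondConfig.relabel (sym2Equiv r)).measurableEmbedding
      (fun ω => ((((zdGraph 3).neighborFinset (0 : Site 3)).filter
        (fun y => s((0 : Site 3), y) ∈ ω)).card : ℝ) *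
          ((Pop ω)^[T] (fun x => if n ≤ x 0 then (1 : ℝ) else 0)) 0) (percolatesAt (0 : Site 3))
    rw [hpre] at h
    exact h
  rw [← hswap]
  -- pointwise on `{0 ↔ ∞}`: `deg_{Rω}(0) = deg_ω(0)` and the covariance identity
  refine setIntegral_congr_fun (measurableSet_percolatesAt_holds 0) (fun ω _ => ?_)
  rw [card_filter_relabel r hr0 hadj ω, hcov ω]

end Summit.CriticalPhenomena.PercolationContinuityZ3.Theorems.VerticalGamblersRuin

end
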